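import Summits.Ventures.CertifiedManyBodySolver.Downfold.EmeryAxialSlabLa214SubsA
import Summits.Ventures.CertifiedManyBodySolver.Downfold.EmeryAxialSlabLa214SubsB
import Summits.Ventures.CertifiedManyBodySolver.Downfold.EmeryFermiFillingLa214
import HarnessLib

/-!
# La₂CuO₄ (box #13 La-214 family, x = 0; typed companion emeryBoxLa214v123): HOW MUCH AXIAL (Cu-4s / apical) ADMIXTURE DOES THE BOX'S ONE-BAND FERMI SURFACE REQUIRE? — the certified
# co-shift census of the typed 3BE one-body box `emeryBoxLa214v123` against its object-E row `t′/t ∈ [-0.3, -0.2]`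

Venture CertifiedManyBodySolver, cell `pub/hubbard-downfold` (stage S1, HUMAN RULINGS D-0096/D-0098: the 3 → 1 reduction error is carried explicitly),
seat hubbard-downfold-mod-4 (technique B = band level); namespace `Summit.Ventures.CertifiedManyBodySolver.Downfold.Emery`. Everything PROVED; numerics
decided by the kernel in `EmeryAxialSlabLa214SubsA`, `EmeryAxialSlabLa214SubsB`.

CONTEXT. `EmeryFermiFilling…` certified the σ three-band (d–p_x–p_y + t_pp, t_pp′) Fermi-surface `t′/t` window of this box at its own
hole count and compared it with the box's object-E row (router/BOXES/La2CuO4-family.md object-E row «tp/t (E) [−0.30, −0.20]»). `EmeryAxialFermiSurfaceShape` +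
`EmeryAxialConductionBand` (TRANSFER THEOREM `condBand_le_iff`, no separation hypothesis) prove that the four-orbital model of [AndersenEtAl1995] /
[PavariniEtAl2001] — Cu-4s (and through it the apical orbitals) added to the σ model — has, AT ITS FERMI LEVEL, exactly the conduction-band occupied
set, filling and Fermi surface of the σ model with CO-SHIFTED O–O hoppings `(t_pp + a, t_pp′ + a)`, ONE scalar `a = a_F = t_sp²/(ε_s − ε_F) ≥ 0`.
So «how much axial channel does the one-band FS of record require beyond the box's σ rows?» is a one-parameter question, answered here slab by slab
(sub-box rule version B, `EmeryFermiFillingSubBoxB`; edges 0, 0.05, 0.1, 0.15, 0.2, 0.25, 0.3, 0.4 eV; Δ_pd × t_pd split 4 × 1):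

| slab | a (eV) | ε_F window (eV above ε_d) | certified t′/t window | vs E row [-0.3, -0.2] |
|---|---|---|---|---|
| 0 | [0, 0.05] | [1.06, 2.74] | [-0.3195, -0.1641] | MEETS |
| 1 | [0.05, 0.1] | [1.04, 2.7] | [-0.345, -0.1881] | MEETS |
| 2 | [0.1, 0.15] | [1.04, 2.68] | [-0.3691, -0.2104] | MEETS |
| 3 | [0.15, 0.2] | [1.02, 2.66] | [-0.3917, -0.229] | MEETS |
| 4 | [0.2, 0.25] | [1.02, 2.64] | [-0.4128, -0.2456] | MEETS |
| 5 | [0.25, 0.3] | [1.02, 2.62] | [-0.4324, -0.261] | MEETS |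
| 6 | [0.3, 0.4] | [0.98, 2.64] | [-0.4718, -0.2748] | MEETS |

READING (certified, numbers not adjectives): every slab MEETS the E row (no exclusion certified at this resolution). The four-orbital form of the exclusion(s) is `emeryBoxLa214v123_fourOrbital_short`:
for ANY axial level `ε_s` and coupling `t_sp`, a four-orbital completion of a box point whose conduction band holds the box's electrons at a Fermi level `ε_F < ε_s`
with `t_sp²/(ε_s − ε_F)` in the excluded range does NOT reproduce the E row. (Pavarini's range parameter for the PURE four-orbital model is
`r = ½/(1 + s)`, `s = (ε_s − ε_F)(ε_F − ε_p)/(2t_sp)² = (ε_F + Δ_pd)/(4·a_total)`, where `a_total` would be the WHOLE O–O co-shift; the box's `t_pp, t_pp′` rows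
already contain part of the axial channel when they come from a three-band Wannier fit, so `a_F` here is the ADDITIONAL admixture — a model-form
distance, not a material constant.)

WHAT THIS IS NOT: not a statement that the material's parameters ARE in the box (SCREENING-GRADE provenance); `U = 0` band kinematics; no phase
sentence; the E row is a [float] literature refit. Sources: [AndersenEtAl1995, §§5–6]; [PavariniEtAl2001, Eqs. (1)–(3), Fig. 3];
[HybertsenSchluterChristensen1989, Eq. (1)].
-/

noncomputable section

namespace Summit.Ventures.CertifiedManyBodySolver.Downfold.Emery

open Real Set
open Summit.Ventures.CertifiedManyBodySolver.Downfold

/-! ## §1 Slab windows (raw co-shifted coordinates `t_pp′ := t_pp + a`, `c′ := t_pp′ + a`) -/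

/-- **Slab 0, a ∈ [0, 0.05] eV**: on the co-shifted box (t_pp + a ∈ [0.46, 0.71], t_pp′ + a ∈ [0.12, 0.2]) at per-spin
filling ∈ [0.495, 0.505]: `ε_F ∈ [1.06, 2.74]` and `t′/t ∈ [-0.3195, -0.1641]` — MEETS vs the E row. [folklore] -/
theorem la214AxSlab0_window {Δ tpd tpp c ε : ℝ} (hΔ : Δ ∈ Set.Icc (17 / 10 : ℝ) (4 : ℝ))
    (ha : tpd ∈ Set.Icc (129 / 100 : ℝ) (38 / 25 : ℝ)) (hb : tpp ∈ Set.Icc (23 / 50 : ℝ) (71 / 100 : ℝ))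
    (hc : c ∈ Set.Icc (3 / 25 : ℝ) (1 / 5 : ℝ))
    (hν : abFilling Δ tpd tpp c ε ∈ Set.Icc (99 / 200 : ℝ) (101 / 200 : ℝ)) :
    ε ∈ Set.Icc (53 / 50 : ℝ) (137 / 50 : ℝ) ∧ fsRatio Δ tpd tpp c ε ∈ Set.Icc (-(639 / 2000 : ℝ)) (-(1641 / 10000 : ℝ)) := by
  have hΔ' := hΔ
  constructor
  · clear hΔ
    rcases mem_Icc_split hΔ' (57 / 20 : ℝ) with hΔ' | hΔ'
    · rcases mem_Icc_split hΔ' (91 / 40 : ℝ) with hΔ' | hΔ'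
      · have h := (la214Ax0Sub_0_0 hΔ' ha hb hc hν).1
        exact ⟨le_trans (by norm_num) h.1, h.2.trans (by norm_num)⟩
      · have h := (la214Ax0Sub_1_0 hΔ' ha hb hc hν).1
        exact ⟨le_trans (by norm_num) h.1, h.2.trans (by norm_num)⟩
    · rcases mem_Icc_split hΔ' (137 / 40 : ℝ) with hΔ' | hΔ'
      · have h := (la214Ax0Sub_2_0 hΔ' ha hb hc hν).1
        exact ⟨le_trans (by norm_num) h.1, h.2.trans (by norm_num)⟩
      · have h := (la214Ax0Sub_3_0 hΔ' ha hb hc hν).1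
        exact ⟨le_trans (by norm_num) h.1, h.2.trans (by norm_num)⟩
  · clear hΔ
    rcases mem_Icc_split hΔ' (57 / 20 : ℝ) with hΔ' | hΔ'
    · rcases mem_Icc_split hΔ' (91 / 40 : ℝ) with hΔ' | hΔ'
      · have h := (la214Ax0Sub_0_0 hΔ' ha hb hc hν).2
        exact ⟨le_trans (by norm_num) h.1, h.2.trans (by norm_num)⟩
      · have h := (la214Ax0Sub_1_0 hΔ' ha hb hc hν).2
        exact ⟨le_trans (by norm_num) h.1, h.2.trans (by norm_num)⟩
    · rcases mem_Icc_split hΔ' (137 / 40 : ℝ) with hΔ' | hΔ'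
      · have h := (la214Ax0Sub_2_0 hΔ' ha hb hc hν).2
        exact ⟨le_trans (by norm_num) h.1, h.2.trans (by norm_num)⟩
      · have h := (la214Ax0Sub_3_0 hΔ' ha hb hc hν).2
        exact ⟨le_trans (by norm_num) h.1, h.2.trans (by norm_num)⟩

/-- **Slab 1, a ∈ [0.05, 0.1] eV**: on the co-shifted box (t_pp + a ∈ [0.51, 0.76], t_pp′ + a ∈ [0.17, 0.25]) at per-spin
filling ∈ [0.495, 0.505]: `ε_F ∈ [1.04, 2.7]` and `t′/t ∈ [-0.345, -0.1881]` — MEETS vs the E row. [folklore] -/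
theorem la214AxSlab1_window {Δ tpd tpp c ε : ℝ} (hΔ : Δ ∈ Set.Icc (17 / 10 : ℝ) (4 : ℝ))
    (ha : tpd ∈ Set.Icc (129 / 100 : ℝ) (38 / 25 : ℝ)) (hb : tpp ∈ Set.Icc (51 / 100 : ℝ) (19 / 25 : ℝ))
    (hc : c ∈ Set.Icc (17 / 100 : ℝ) (1 / 4 : ℝ))
    (hν : abFilling Δ tpd tpp c ε ∈ Set.Icc (99 / 200 : ℝ) (101 / 200 : ℝ)) :
    ε ∈ Set.Icc (26 / 25 : ℝ) (27 / 10 : ℝ) ∧ fsRatio Δ tpd tpp c ε ∈ Set.Icc (-(69 / 200 : ℝ)) (-(1881 / 10000 : ℝ)) := by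
  have hΔ' := hΔ
  constructor
  · clear hΔ
    rcases mem_Icc_split hΔ' (57 / 20 : ℝ) with hΔ' | hΔ'
    · rcases mem_Icc_split hΔ' (91 / 40 : ℝ) with hΔ' | hΔ'
      · have h := (la214Ax1Sub_0_0 hΔ' ha hb hc hν).1
        exact ⟨le_trans (by norm_num) h.1, h.2.trans (by norm_num)⟩
      · have h := (la214Ax1Sub_1_0 hΔ' ha hb hc hν).1
        exact ⟨le_trans (by norm_num) h.1, h.2.trans (by norm_num)⟩
    · rcases mem_Icc_split hΔ' (137 / 40 : ℝ) with hΔ' | hΔ'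
      · have h := (la214Ax1Sub_2_0 hΔ' ha hb hc hν).1
        exact ⟨le_trans (by norm_num) h.1, h.2.trans (by norm_num)⟩
      · have h := (la214Ax1Sub_3_0 hΔ' ha hb hc hν).1
        exact ⟨le_trans (by norm_num) h.1, h.2.trans (by norm_num)⟩
  · clear hΔ
    rcases mem_Icc_split hΔ' (57 / 20 : ℝ) with hΔ' | hΔ'
    · rcases mem_Icc_split hΔ' (91 / 40 : ℝ) with hΔ' | hΔ'
      · have h := (la214Ax1Sub_0_0 hΔ' ha hb hc hν).2
        exact ⟨le_trans (by norm_num) h.1, h.2.trans (by norm_num)⟩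
      · have h := (la214Ax1Sub_1_0 hΔ' ha hb hc hν).2
        exact ⟨le_trans (by norm_num) h.1, h.2.trans (by norm_num)⟩
    · rcases mem_Icc_split hΔ' (137 / 40 : ℝ) with hΔ' | hΔ'
      · have h := (la214Ax1Sub_2_0 hΔ' ha hb hc hν).2
        exact ⟨le_trans (by norm_num) h.1, h.2.trans (by norm_num)⟩
      · have h := (la214Ax1Sub_3_0 hΔ' ha hb hc hν).2
        exact ⟨le_trans (by norm_num) h.1, h.2.trans (by norm_num)⟩

/-- **Slab 2, a ∈ [0.1, 0.15] eV**: on the co-shifted box (t_pp + a ∈ [0.56, 0.81], t_pp′ + a ∈ [0.22, 0.3]) at per-spin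
filling ∈ [0.495, 0.505]: `ε_F ∈ [1.04, 2.68]` and `t′/t ∈ [-0.3691, -0.2104]` — MEETS vs the E row. [folklore] -/
theorem la214AxSlab2_window {Δ tpd tpp c ε : ℝ} (hΔ : Δ ∈ Set.Icc (17 / 10 : ℝ) (4 : ℝ))
    (ha : tpd ∈ Set.Icc (129 / 100 : ℝ) (38 / 25 : ℝ)) (hb : tpp ∈ Set.Icc (14 / 25 : ℝ) (81 / 100 : ℝ))
    (hc : c ∈ Set.Icc (11 / 50 : ℝ) (3 / 10 : ℝ))
    (hν : abFilling Δ tpd tpp c ε ∈ Set.Icc (99 / 200 : ℝ) (101 / 200 : ℝ)) :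
    ε ∈ Set.Icc (26 / 25 : ℝ) (67 / 25 : ℝ) ∧ fsRatio Δ tpd tpp c ε ∈ Set.Icc (-(3691 / 10000 : ℝ)) (-(263 / 1250 : ℝ)) := by
  have hΔ' := hΔ
  constructor
  · clear hΔ
    rcases mem_Icc_split hΔ' (57 / 20 : ℝ) with hΔ' | hΔ'
    · rcases mem_Icc_split hΔ' (91 / 40 : ℝ) with hΔ' | hΔ'
      · have h := (la214Ax2Sub_0_0 hΔ' ha hb hc hν).1
        exact ⟨le_trans (by norm_num) h.1, h.2.trans (by norm_num)⟩
      · have h := (la214Ax2Sub_1_0 hΔ' ha hb hc hν).1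
        exact ⟨le_trans (by norm_num) h.1, h.2.trans (by norm_num)⟩
    · rcases mem_Icc_split hΔ' (137 / 40 : ℝ) with hΔ' | hΔ'
      · have h := (la214Ax2Sub_2_0 hΔ' ha hb hc hν).1
        exact ⟨le_trans (by norm_num) h.1, h.2.trans (by norm_num)⟩
      · have h := (la214Ax2Sub_3_0 hΔ' ha hb hc hν).1
        exact ⟨le_trans (by norm_num) h.1, h.2.trans (by norm_num)⟩
  · clear hΔ
    rcases mem_Icc_split hΔ' (57 / 20 : ℝ) with hΔ' | hΔ'
    · rcases mem_Icc_split hΔ' (91 / 40 : ℝ) with hΔ' | hΔ'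
      · have h := (la214Ax2Sub_0_0 hΔ' ha hb hc hν).2
        exact ⟨le_trans (by norm_num) h.1, h.2.trans (by norm_num)⟩
      · have h := (la214Ax2Sub_1_0 hΔ' ha hb hc hν).2
        exact ⟨le_trans (by norm_num) h.1, h.2.trans (by norm_num)⟩
    · rcases mem_Icc_split hΔ' (137 / 40 : ℝ) with hΔ' | hΔ'
      · have h := (la214Ax2Sub_2_0 hΔ' ha hb hc hν).2
        exact ⟨le_trans (by norm_num) h.1, h.2.trans (by norm_num)⟩
      · have h := (la214Ax2Sub_3_0 hΔ' ha hb hc hν).2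
        exact ⟨le_trans (by norm_num) h.1, h.2.trans (by norm_num)⟩

/-- **Slab 3, a ∈ [0.15, 0.2] eV**: on the co-shifted box (t_pp + a ∈ [0.61, 0.86], t_pp′ + a ∈ [0.27, 0.35]) at per-spin
filling ∈ [0.495, 0.505]: `ε_F ∈ [1.02, 2.66]` and `t′/t ∈ [-0.3917, -0.229]` — MEETS vs the E row. [folklore] -/
theorem la214AxSlab3_window {Δ tpd tpp c ε : ℝ} (hΔ : Δ ∈ Set.Icc (17 / 10 : ℝ) (4 : ℝ))
    (ha : tpd ∈ Set.Icc (129 / 100 : ℝ) (38 / 25 : ℝ)) (hb : tpp ∈ Set.Icc (61 / 100 : ℝ) (43 / 50 : ℝ))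
    (hc : c ∈ Set.Icc (27 / 100 : ℝ) (7 / 20 : ℝ))
    (hν : abFilling Δ tpd tpp c ε ∈ Set.Icc (99 / 200 : ℝ) (101 / 200 : ℝ)) :
    ε ∈ Set.Icc (51 / 50 : ℝ) (133 / 50 : ℝ) ∧ fsRatio Δ tpd tpp c ε ∈ Set.Icc (-(3917 / 10000 : ℝ)) (-(229 / 1000 : ℝ)) := by
  have hΔ' := hΔ
  constructor
  · clear hΔ
    rcases mem_Icc_split hΔ' (57 / 20 : ℝ) with hΔ' | hΔ'
    · rcases mem_Icc_split hΔ' (91 / 40 : ℝ) with hΔ' | hΔ'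
      · have h := (la214Ax3Sub_0_0 hΔ' ha hb hc hν).1
        exact ⟨le_trans (by norm_num) h.1, h.2.trans (by norm_num)⟩
      · have h := (la214Ax3Sub_1_0 hΔ' ha hb hc hν).1
        exact ⟨le_trans (by norm_num) h.1, h.2.trans (by norm_num)⟩
    · rcases mem_Icc_split hΔ' (137 / 40 : ℝ) with hΔ' | hΔ'
      · have h := (la214Ax3Sub_2_0 hΔ' ha hb hc hν).1
        exact ⟨le_trans (by norm_num) h.1, h.2.trans (by norm_num)⟩
      · have h := (la214Ax3Sub_3_0 hΔ' ha hb hc hν).1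
        exact ⟨le_trans (by norm_num) h.1, h.2.trans (by norm_num)⟩
  · clear hΔ
    rcases mem_Icc_split hΔ' (57 / 20 : ℝ) with hΔ' | hΔ'
    · rcases mem_Icc_split hΔ' (91 / 40 : ℝ) with hΔ' | hΔ'
      · have h := (la214Ax3Sub_0_0 hΔ' ha hb hc hν).2
        exact ⟨le_trans (by norm_num) h.1, h.2.trans (by norm_num)⟩
      · have h := (la214Ax3Sub_1_0 hΔ' ha hb hc hν).2
        exact ⟨le_trans (by norm_num) h.1, h.2.trans (by norm_num)⟩
    · rcases mem_Icc_split hΔ' (137 / 40 : ℝ) with hΔ' | hΔ'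
      · have h := (la214Ax3Sub_2_0 hΔ' ha hb hc hν).2
        exact ⟨le_trans (by norm_num) h.1, h.2.trans (by norm_num)⟩
      · have h := (la214Ax3Sub_3_0 hΔ' ha hb hc hν).2
        exact ⟨le_trans (by norm_num) h.1, h.2.trans (by norm_num)⟩

/-- **Slab 4, a ∈ [0.2, 0.25] eV**: on the co-shifted box (t_pp + a ∈ [0.66, 0.91], t_pp′ + a ∈ [0.32, 0.4]) at per-spin
filling ∈ [0.495, 0.505]: `ε_F ∈ [1.02, 2.64]` and `t′/t ∈ [-0.4128, -0.2456]` — MEETS vs the E row. [folklore] -/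
theorem la214AxSlab4_window {Δ tpd tpp c ε : ℝ} (hΔ : Δ ∈ Set.Icc (17 / 10 : ℝ) (4 : ℝ))
    (ha : tpd ∈ Set.Icc (129 / 100 : ℝ) (38 / 25 : ℝ)) (hb : tpp ∈ Set.Icc (33 / 50 : ℝ) (91 / 100 : ℝ))
    (hc : c ∈ Set.Icc (8 / 25 : ℝ) (2 / 5 : ℝ))
    (hν : abFilling Δ tpd tpp c ε ∈ Set.Icc (99 / 200 : ℝ) (101 / 200 : ℝ)) :
    ε ∈ Set.Icc (51 / 50 : ℝ) (66 / 25 : ℝ) ∧ fsRatio Δ tpd tpp c ε ∈ Set.Icc (-(258 / 625 : ℝ)) (-(307 / 1250 : ℝ)) := by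
  have hΔ' := hΔ
  constructor
  · clear hΔ
    rcases mem_Icc_split hΔ' (57 / 20 : ℝ) with hΔ' | hΔ'
    · rcases mem_Icc_split hΔ' (91 / 40 : ℝ) with hΔ' | hΔ'
      · have h := (la214Ax4Sub_0_0 hΔ' ha hb hc hν).1
        exact ⟨le_trans (by norm_num) h.1, h.2.trans (by norm_num)⟩
      · have h := (la214Ax4Sub_1_0 hΔ' ha hb hc hν).1
        exact ⟨le_trans (by norm_num) h.1, h.2.trans (by norm_num)⟩
    · rcases mem_Icc_split hΔ' (137 / 40 : ℝ) with hΔ' | hΔ'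
      · have h := (la214Ax4Sub_2_0 hΔ' ha hb hc hν).1
        exact ⟨le_trans (by norm_num) h.1, h.2.trans (by norm_num)⟩
      · have h := (la214Ax4Sub_3_0 hΔ' ha hb hc hν).1
        exact ⟨le_trans (by norm_num) h.1, h.2.trans (by norm_num)⟩
  · clear hΔ
    rcases mem_Icc_split hΔ' (57 / 20 : ℝ) with hΔ' | hΔ'
    · rcases mem_Icc_split hΔ' (91 / 40 : ℝ) with hΔ' | hΔ'
      · have h := (la214Ax4Sub_0_0 hΔ' ha hb hc hν).2
        exact ⟨le_trans (by norm_num) h.1, h.2.trans (by norm_num)⟩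
      · have h := (la214Ax4Sub_1_0 hΔ' ha hb hc hν).2
        exact ⟨le_trans (by norm_num) h.1, h.2.trans (by norm_num)⟩
    · rcases mem_Icc_split hΔ' (137 / 40 : ℝ) with hΔ' | hΔ'
      · have h := (la214Ax4Sub_2_0 hΔ' ha hb hc hν).2
        exact ⟨le_trans (by norm_num) h.1, h.2.trans (by norm_num)⟩
      · have h := (la214Ax4Sub_3_0 hΔ' ha hb hc hν).2
        exact ⟨le_trans (by norm_num) h.1, h.2.trans (by norm_num)⟩

/-- **Slab 5, a ∈ [0.25, 0.3] eV**: on the co-shifted box (t_pp + a ∈ [0.71, 0.96], t_pp′ + a ∈ [0.37, 0.45]) at per-spin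
filling ∈ [0.495, 0.505]: `ε_F ∈ [1.02, 2.62]` and `t′/t ∈ [-0.4324, -0.261]` — MEETS vs the E row. [folklore] -/
theorem la214AxSlab5_window {Δ tpd tpp c ε : ℝ} (hΔ : Δ ∈ Set.Icc (17 / 10 : ℝ) (4 : ℝ))
    (ha : tpd ∈ Set.Icc (129 / 100 : ℝ) (38 / 25 : ℝ)) (hb : tpp ∈ Set.Icc (71 / 100 : ℝ) (24 / 25 : ℝ))
    (hc : c ∈ Set.Icc (37 / 100 : ℝ) (9 / 20 : ℝ))
    (hν : abFilling Δ tpd tpp c ε ∈ Set.Icc (99 / 200 : ℝ) (101 / 200 : ℝ)) :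
    ε ∈ Set.Icc (51 / 50 : ℝ) (131 / 50 : ℝ) ∧ fsRatio Δ tpd tpp c ε ∈ Set.Icc (-(1081 / 2500 : ℝ)) (-(261 / 1000 : ℝ)) := by
  have hΔ' := hΔ
  constructor
  · clear hΔ
    rcases mem_Icc_split hΔ' (57 / 20 : ℝ) with hΔ' | hΔ'
    · rcases mem_Icc_split hΔ' (91 / 40 : ℝ) with hΔ' | hΔ'
      · have h := (la214Ax5Sub_0_0 hΔ' ha hb hc hν).1
        exact ⟨le_trans (by norm_num) h.1, h.2.trans (by norm_num)⟩
      · have h := (la214Ax5Sub_1_0 hΔ' ha hb hc hν).1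
        exact ⟨le_trans (by norm_num) h.1, h.2.trans (by norm_num)⟩
    · rcases mem_Icc_split hΔ' (137 / 40 : ℝ) with hΔ' | hΔ'
      · have h := (la214Ax5Sub_2_0 hΔ' ha hb hc hν).1
        exact ⟨le_trans (by norm_num) h.1, h.2.trans (by norm_num)⟩
      · have h := (la214Ax5Sub_3_0 hΔ' ha hb hc hν).1
        exact ⟨le_trans (by norm_num) h.1, h.2.trans (by norm_num)⟩
  · clear hΔ
    rcases mem_Icc_split hΔ' (57 / 20 : ℝ) with hΔ' | hΔ'
    · rcases mem_Icc_split hΔ' (91 / 40 : ℝ) with hΔ' | hΔ'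
      · have h := (la214Ax5Sub_0_0 hΔ' ha hb hc hν).2
        exact ⟨le_trans (by norm_num) h.1, h.2.trans (by norm_num)⟩
      · have h := (la214Ax5Sub_1_0 hΔ' ha hb hc hν).2
        exact ⟨le_trans (by norm_num) h.1, h.2.trans (by norm_num)⟩
    · rcases mem_Icc_split hΔ' (137 / 40 : ℝ) with hΔ' | hΔ'
      · have h := (la214Ax5Sub_2_0 hΔ' ha hb hc hν).2
        exact ⟨le_trans (by norm_num) h.1, h.2.trans (by norm_num)⟩
      · have h := (la214Ax5Sub_3_0 hΔ' ha hb hc hν).2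
        exact ⟨le_trans (by norm_num) h.1, h.2.trans (by norm_num)⟩

/-- **Slab 6, a ∈ [0.3, 0.4] eV**: on the co-shifted box (t_pp + a ∈ [0.76, 1.06], t_pp′ + a ∈ [0.42, 0.55]) at per-spin
filling ∈ [0.495, 0.505]: `ε_F ∈ [0.98, 2.64]` and `t′/t ∈ [-0.4718, -0.2748]` — MEETS vs the E row. [folklore] -/
theorem la214AxSlab6_window {Δ tpd tpp c ε : ℝ} (hΔ : Δ ∈ Set.Icc (17 / 10 : ℝ) (4 : ℝ))
    (ha : tpd ∈ Set.Icc (129 / 100 : ℝ) (38 / 25 : ℝ)) (hb : tpp ∈ Set.Icc (19 / 25 : ℝ) (53 / 50 : ℝ))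
    (hc : c ∈ Set.Icc (21 / 50 : ℝ) (11 / 20 : ℝ))
    (hν : abFilling Δ tpd tpp c ε ∈ Set.Icc (99 / 200 : ℝ) (101 / 200 : ℝ)) :
    ε ∈ Set.Icc (49 / 50 : ℝ) (66 / 25 : ℝ) ∧ fsRatio Δ tpd tpp c ε ∈ Set.Icc (-(2359 / 5000 : ℝ)) (-(687 / 2500 : ℝ)) := by
  have hΔ' := hΔ
  constructor
  · clear hΔ
    rcases mem_Icc_split hΔ' (57 / 20 : ℝ) with hΔ' | hΔ'
    · rcases mem_Icc_split hΔ' (91 / 40 : ℝ) with hΔ' | hΔ'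
      · have h := (la214Ax6Sub_0_0 hΔ' ha hb hc hν).1
        exact ⟨le_trans (by norm_num) h.1, h.2.trans (by norm_num)⟩
      · have h := (la214Ax6Sub_1_0 hΔ' ha hb hc hν).1
        exact ⟨le_trans (by norm_num) h.1, h.2.trans (by norm_num)⟩
    · rcases mem_Icc_split hΔ' (137 / 40 : ℝ) with hΔ' | hΔ'
      · have h := (la214Ax6Sub_2_0 hΔ' ha hb hc hν).1
        exact ⟨le_trans (by norm_num) h.1, h.2.trans (by norm_num)⟩
      · have h := (la214Ax6Sub_3_0 hΔ' ha hb hc hν).1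
        exact ⟨le_trans (by norm_num) h.1, h.2.trans (by norm_num)⟩
  · clear hΔ
    rcases mem_Icc_split hΔ' (57 / 20 : ℝ) with hΔ' | hΔ'
    · rcases mem_Icc_split hΔ' (91 / 40 : ℝ) with hΔ' | hΔ'
      · have h := (la214Ax6Sub_0_0 hΔ' ha hb hc hν).2
        exact ⟨le_trans (by norm_num) h.1, h.2.trans (by norm_num)⟩
      · have h := (la214Ax6Sub_1_0 hΔ' ha hb hc hν).2
        exact ⟨le_trans (by norm_num) h.1, h.2.trans (by norm_num)⟩
    · rcases mem_Icc_split hΔ' (137 / 40 : ℝ) with hΔ' | hΔ'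
      · have h := (la214Ax6Sub_2_0 hΔ' ha hb hc hν).2
        exact ⟨le_trans (by norm_num) h.1, h.2.trans (by norm_num)⟩
      · have h := (la214Ax6Sub_3_0 hΔ' ha hb hc hν).2
        exact ⟨le_trans (by norm_num) h.1, h.2.trans (by norm_num)⟩

end Summit.Ventures.CertifiedManyBodySolver.Downfold.Emery
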